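import Literature.NumberTheory.LFunctions.ThetaChainFreeCheck
import HarnessLib

/-!
# Schoenfeld's `θ`-bound on `[599, 10⁸]` by kernel computation: data-free run, chunk 28 of 35

Topic: `Literature/NumberTheory/LFunctions`. Pure proof file (a kernel computation; nothing is
asserted, no definition). The theorems below evaluate `ThetaChain.runFree` — together `150000`
data-free steps of the certified `θ`-chain (`ThetaChain.stepFree`, `ThetaChainFreeCheck.lean`: the
next prime found and certified by two gcds with the primorials of the odd primes `≤ 2999` and in
`(2999, 10007]`, the enclosures of `log p` and `θ(p)`, and the two comparisons behind
`|θ(x) − x| ≤ √x log² x/(8π)`) — from the state at the prime `79561711` to the state at the prime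
`82291571`. Soundness: `ThetaChain.runFree_sound`; assembly of the 35 chunks: `ThetaUpTo1e8.lean`.
The expected states were obtained by evaluating a twin of the same function outside the kernel
(validated bit-for-bit on the tree's chunk `ThetaChainRun.xrun14`). Declarations of `5·10⁴` steps
(about `70 s` of kernel time each; the kernel's evaluation is linear within a declaration of this size),
`decide +kernel`, standard axioms only (`maxHeartbeats 0` lifts the deterministic time-out).

## References

* L. Schoenfeld, *Sharper bounds for the Chebyshev functions θ(x) and ψ(x). II*, Math. Comp. 30
  (1976), 337–360, Thm. 10 (6.3). [Schoenfeld1976]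
* J. B. Rosser, L. Schoenfeld, *Approximate formulas for some functions of prime numbers*,
  Illinois J. Math. 6 (1962), 64–94, Thms. 18–19 (`θ`-tables to `10⁸`). [RosserSchoenfeld1962]
-/

namespace Literature.NumberTheory.LFunctions.ThetaChainRun

open ThetaChain

set_option maxHeartbeats 0 in
/-- **Data-free certified `θ`-run, chunk 28a** (steps `4050001`–`4100000` after `8886113`: 50000 primes,
`79561711` to `80471719`). [cite: Schoenfeld1976, Thm. 10 (6.3)] -/
theorem frun28a :
    runFree 50000
      ⟨79561711, 21992831119859177331254625, 21992831119859653029697932, 96171470025493420169307583882691, 96171470025495629742612504537270⟩ =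
    some ⟨80471719, 22006580047504750071963510, 22006580047505225771357077, 97271456316194119110629681549456, 97271456316196352468880525640260⟩ := by
  decide +kernel

set_option maxHeartbeats 0 in
/-- **Data-free certified `θ`-run, chunk 28b** (steps `4100001`–`4150000` after `8886113`: 50000 primes,
`80471719` to `81379393`). [cite: Schoenfeld1976, Thm. 10 (6.3)] -/
theorem frun28b :
    runFree 50000
      ⟨80471719, 22006580047504750071963510, 22006580047505225771357077, 97271456316194119110629681549456, 97271456316196352468880525640260⟩ =
    some ⟨81379393, 22020139695315977676755566, 22020139695316453377099288, 98372125086517357268056474639335, 98372125086519614411300751557894⟩ := by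
  decide +kernel

set_option maxHeartbeats 0 in
/-- **Data-free certified `θ`-run, chunk 28c** (steps `4150001`–`4200000` after `8886113`: 50000 primes,
`81379393` to `82291571`). [cite: Schoenfeld1976, Thm. 10 (6.3)] -/
theorem frun28c :
    runFree 50000
      ⟨81379393, 22020139695315977676755566, 22020139695316453377099288, 98372125086517357268056474639335, 98372125086519614411300751557894⟩ =
    some ⟨82291571, 22033615108756725740673297, 22033615108757201441967209, 99473468975227370004000033546976, 99473468975229650932285251664145⟩ := by
  decide +kernel

end Literature.NumberTheory.LFunctions.ThetaChainRun
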